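import Summits.CriticalPhenomena.CardyFormulaZ2.Theses.CardyMagicRigidity
import Literature.Probability.Percolation.CardyFormulaConformalInvariance
import Literature.Probability.Percolation.BoxCrossingUpperBound
import Literature.Probability.Percolation.ZdNearCriticalWindow
import Literature.Probability.Percolation.HalfSpacePinnedPairs
import Literature.Probability.Percolation.SharpnessDCTProofs
import Literature.Probability.Percolation.QuadCrossingSquareModel
import Literature.Probability.Percolation.FullPlaneCNL
import Literature.Probability.Percolation.AnnulusCrossingBoundProofs
import Literature.Probability.Percolation.TriAnnulusCrossingProofs
import Literature.Probability.Percolation.TriAnnulusArms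
import Literature.Probability.Percolation.SiteConnectionTools
import Literature.Probability.Percolation.TriHexLemma
import Literature.Probability.LatticeModels.TriangularLatticeProofs
import Literature.Probability.RandomPlanarGeometry.ConformalRectangleProofs

/-!
# C-plan: the decomposition of stub C (`stub_transfer_tri_to_bond`) of line `oracle-sandwich`

Lead's working file (crux stmt-CriticalPhenomena-4837).  Engine: mono-polarisation + loop transfer,
all events PLATE-STYLE in the coordinates of a square model `Φ` of the quad `Q`
(`IsSquareModel Q Φ`, `exists_isSquareModel`: `Φ (-1,1)² = Q`, arc `0` = bottom `im = -1`,
arc `2` = top, arcs `1`/`3` = right/left), so that "harder/easier with room" is an inequality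
between box parameters and every comparison has metric room `≫ η ≫ δ`.

Pieces (each to become a registered stub or a Literature lemma):
* `PlateContainment`  (S0, geometry): the primal vertical plate event of `P₂ = (1+κ, 1-κ, 1+κ)` is a
  bond plate path of `(Q, r)`.
* `PolarZ` (S1, ℤ² only, X-free): `2·P(V_Z(P₂)) ≥ P(MV_Z(P')) + 1 − P(MH_Z(P'♭))` eventually in δ
  (self-duality + translation, inclusions, ℤ² mono-duality with room via continuum quad duality +
  `DualFaceChains`).
* `PolarT` (S2, 𝕋 only, X-free): `P(MV_T(P₃)) + 1 − P(MH_T(P₄)) ≥ 2·tri(Q)` eventually in δ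
  (colour flip, G02 ⇒ plate inclusion, plate-crossing blocks G02 crossing of the other colour,
  𝕋 mono-duality with room).
* `MonoTransfer` (S3, uses X): `P(MV_Z(P')) ≥ P(MV_T(P₃)) − ε` and `P(MH_Z(P'♭)) ≤ P(MH_T(P₄)) + ε`
  eventually (coupling from X + window confinement + the two deterministic sub-arc transfers).
* `transfer_of_pieces`: S0–S3 ⇒ stub C (proved below).
-/

noncomputable section

namespace Summit.CriticalPhenomena.CardyFormulaZ2.Cruxes.LoopsToCrossings.OracleSandwich

open Summit.CriticalPhenomena.CardyFormulaZ2.Theses.CardyMagicRigidity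
open Literature.Probability.RandomPlanarGeometry hiding cardyFunction
open Literature.Probability.Percolation hiding cardyFunction
open Literature.Probability.LatticeModels
open Filter Topology Set MeasureTheory Metric Complex

/-! ## Plate events in square-model coordinates -/

/-- The closed box `[-x, x] × [-y, y]`. [folklore] -/
def pbox (x y : ℝ) : Set ℂ := Icc (-x) x ×ℂ Icc (-y) y

/-- Critical bond percolation on `ℤ²`. [folklore] -/
abbrev PZ : Measure (BondConfig (Site 2)) := bondPercolation (zdGraph 2) half
/-- Critical site percolation on `𝕋`. [folklore] -/
abbrev PT : Measure (SiteConfig (Site 2)) := triSitePercolation half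

/-- ℤ² primal VERTICAL plate crossing: an open path drawn (by `draw`) inside `Φ(pbox x yout)` from
the zone `im ≤ -yin` to the zone `yin ≤ im`. [folklore] -/
def zdV (draw : Site 2 → ℂ) (Φ : ℂ ≃ₜ ℂ) (x yin yout : ℝ) : Set (BondConfig (Site 2)) :=
  openCrossing {w | draw w ∈ Φ '' pbox x yout} {w | draw w ∈ Φ '' {z | z.im ≤ -yin}}
    {w | draw w ∈ Φ '' {z | yin ≤ z.im}}

/-- ℤ² primal HORIZONTAL plate crossing inside `Φ(pbox xout y)` from `re ≤ -xin` to `xin ≤ re`.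
[folklore] -/
def zdH (draw : Site 2 → ℂ) (Φ : ℂ ≃ₜ ℂ) (xin xout y : ℝ) : Set (BondConfig (Site 2)) :=
  openCrossing {w | draw w ∈ Φ '' pbox xout y} {w | draw w ∈ Φ '' {z | z.re ≤ -xin}}
    {w | draw w ∈ Φ '' {z | xin ≤ z.re}}

/-- The primal drawing at mesh `δ`. [folklore] -/
abbrev drawP (δ : ℝ) : Site 2 → ℂ := meshPoint δ
/-- The dual drawing at mesh `δ` (face `f` at `δ f + δ(½,½)`). [folklore] -/
abbrev drawD (δ : ℝ) : Site 2 → ℂ := fun f ↦ dualScale δ (Site.toComplex f)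

/-- Mono VERTICAL plate crossing on `ℤ²`: primal-open or dual-open. [folklore] -/
def zdMV (Φ : ℂ ≃ₜ ℂ) (δ x yin yout : ℝ) : Set (BondConfig (Site 2)) :=
  zdV (drawP δ) Φ x yin yout ∪ dualConfig ⁻¹' zdV (drawD δ) Φ x yin yout

/-- Mono HORIZONTAL plate crossing on `ℤ²`. [folklore] -/
def zdMH (Φ : ℂ ≃ₜ ℂ) (δ xin xout y : ℝ) : Set (BondConfig (Site 2)) :=
  zdH (drawP δ) Φ xin xout y ∪ dualConfig ⁻¹' zdH (drawD δ) Φ xin xout y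

/-- 𝕋 open VERTICAL plate crossing. [folklore] -/
def triV (Φ : ℂ ≃ₜ ℂ) (δ x yin yout : ℝ) : Set (SiteConfig (Site 2)) :=
  {ω | ∃ u ∈ {w : Site 2 | triMeshPoint δ w ∈ Φ '' {z | z.im ≤ -yin}},
    ∃ v ∈ {w : Site 2 | triMeshPoint δ w ∈ Φ '' {z | yin ≤ z.im}},
      ω ∈ siteConnIn triGraph {w | triMeshPoint δ w ∈ Φ '' pbox x yout} u v}

/-- 𝕋 open HORIZONTAL plate crossing. [folklore] -/
def triH (Φ : ℂ ≃ₜ ℂ) (δ xin xout y : ℝ) : Set (SiteConfig (Site 2)) :=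
  {ω | ∃ u ∈ {w : Site 2 | triMeshPoint δ w ∈ Φ '' {z | z.re ≤ -xin}},
    ∃ v ∈ {w : Site 2 | triMeshPoint δ w ∈ Φ '' {z | xin ≤ z.re}},
      ω ∈ siteConnIn triGraph {w | triMeshPoint δ w ∈ Φ '' pbox xout y} u v}

/-- Mono VERTICAL plate crossing on `𝕋`: open or closed. [folklore] -/
def triMV (Φ : ℂ ≃ₜ ℂ) (δ x yin yout : ℝ) : Set (SiteConfig (Site 2)) :=
  triV Φ δ x yin yout ∪ compl ⁻¹' triV Φ δ x yin yout

/-- Mono HORIZONTAL plate crossing on `𝕋`. [folklore] -/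
def triMH (Φ : ℂ ≃ₜ ℂ) (δ xin xout y : ℝ) : Set (SiteConfig (Site 2)) :=
  triH Φ δ xin xout y ∪ compl ⁻¹' triH Φ δ xin xout y

/-! ## The four pieces, as named statements

Parameters: `κ ∈ (0, 1/2]` is the plate room of `(Q, r)` in model coordinates; the seven plates are
fixed rational points of the `κ`-grid:
`P₂ = V(1+κ, 1-κ, 1+κ)` (easiest vertical plate = (half-width, zone height, plate height)),
`P' = V(1+4κ/5, 1-4κ/5, 1+4κ/5)`, `P₃ = V(1+11κ/20, 1-11κ/20, 1+11κ/20)` (vertical, harder and harder),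
`P'♭ = H(1+3κ/5, 1+4κ/5, 1-3κ/5)` (horizontal = (zone abscissa, plate half-width, plate half-height)),
`P₄ = H(1+3κ/10, 1+11κ/20, 1-3κ/10)` (horizontal, easier than `P'♭`); inside S2 also
`P₄♭ = V(1+κ/2, 1-κ/2, 1+κ/2)`.  Orderings used: `V(P₃) ⊐ V(P') ⊐ V(P₂)`, `H(P'♭)` spans less than
the width of `P'` and more than its zone height, `H(P₄)` easier than `H(P'♭)`, `Q = Φ(-1,1)²` sits
inside the plate of `P₃`/`P₄` horizontally resp. is spanned by their zones. -/

/-- S0: the primal vertical plate event of `P₂` is a bond plate path of `(Q, r)`. [folklore] -/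
def PlateContainment : Prop :=
  ∀ (Q : ConformalRectangle) (Φ : ℂ ≃ₜ ℂ), IsSquareModel Q Φ → ∀ r : ℝ, 0 < r →
    ∃ κ : ℝ, 0 < κ ∧ κ ≤ 1 / 2 ∧ ∀ δ : ℝ, 0 < δ →
      zdV (drawP δ) Φ (1 + κ) (1 - κ) (1 + κ) ⊆
        openCrossing {x : Site 2 | meshPoint δ x ∈ cthickening r Q.carrier}
          {x | meshPoint δ x ∈ cthickening r (Q.arc 0)} {x | meshPoint δ x ∈ cthickening r (Q.arc 2)}

/-- S1 (ℤ², X-free): polarisation lower bound with room. [folklore] -/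
def PolarZ : Prop :=
  ∀ (Φ : ℂ ≃ₜ ℂ) (κ : ℝ), 0 < κ → κ ≤ 1 / 2 → ∀ᶠ δ : ℝ in 𝓝[>] 0,
    PZ.real (zdMV Φ δ (1 + 4 * κ / 5) (1 - 4 * κ / 5) (1 + 4 * κ / 5)) + 1 -
        PZ.real (zdMH Φ δ (1 + 3 * κ / 5) (1 + 4 * κ / 5) (1 - 3 * κ / 5)) ≤
      2 * PZ.real (zdV (drawP δ) Φ (1 + κ) (1 - κ) (1 + κ))

/-- S2 (𝕋, X-free): the 𝕋 side of the polarisation, against the G02 crossing probability of `Q`.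
[folklore] -/
def PolarT : Prop :=
  ∀ (Q : ConformalRectangle) (Φ : ℂ ≃ₜ ℂ), IsSquareModel Q Φ → ∀ κ : ℝ, 0 < κ → κ ≤ 1 / 2 →
    ∀ᶠ δ : ℝ in 𝓝[>] 0,
      2 * triDomainCrossingProb Q δ ≤
        PT.real (triMV Φ δ (1 + 11 * κ / 20) (1 - 11 * κ / 20) (1 + 11 * κ / 20)) + 1 -
          PT.real (triMH Φ δ (1 + 3 * κ / 10) (1 + 11 * κ / 20) (1 - 3 * κ / 10))

/-- S3 (uses `X`): the two mono transfers with room, as probability inequalities. [folklore] -/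
def MonoTransfer : Prop :=
  LoopLimitZ2EqT → ∀ (Φ : ℂ ≃ₜ ℂ) (κ : ℝ), 0 < κ → κ ≤ 1 / 2 → ∀ ε : ℝ, 0 < ε →
    ∀ᶠ δ : ℝ in 𝓝[>] 0,
      PT.real (triMV Φ δ (1 + 11 * κ / 20) (1 - 11 * κ / 20) (1 + 11 * κ / 20)) ≤
          PZ.real (zdMV Φ δ (1 + 4 * κ / 5) (1 - 4 * κ / 5) (1 + 4 * κ / 5)) + ε ∧
        PZ.real (zdMH Φ δ (1 + 3 * κ / 5) (1 + 4 * κ / 5) (1 - 3 * κ / 5)) ≤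
          PT.real (triMH Φ δ (1 + 3 * κ / 10) (1 + 11 * κ / 20) (1 - 3 * κ / 10)) + ε

/-! ## Assembly: the four pieces give stub C -/

/-- **Stub C from S0–S3.** [folklore] -/
theorem transfer_of_pieces (h0 : PlateContainment) (h1 : PolarZ) (h2 : PolarT) (h3 : MonoTransfer) :
    LoopLimitZ2EqT →
      ∀ (Q : ConformalRectangle) (r : ℝ), 0 < r → ∀ ε : ℝ, 0 < ε →
        ∀ᶠ δ : ℝ in 𝓝[>] 0,
          triDomainCrossingProb Q δ ≤
            (bondPercolation (zdGraph 2) half).real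
              (openCrossing {x : Site 2 | meshPoint δ x ∈ cthickening r Q.carrier}
                {x | meshPoint δ x ∈ cthickening r (Q.arc 0)}
                {x | meshPoint δ x ∈ cthickening r (Q.arc 2)}) + ε := by
  intro hX Q r hr ε hε
  obtain ⟨Φ, hΦ⟩ := exists_isSquareModel Q
  obtain ⟨κ, hκ, hκ1, hcont⟩ := h0 Q Φ hΦ r hr
  have e1 := h1 Φ κ hκ hκ1
  have e2 := h2 Q Φ hΦ κ hκ hκ1
  have e3 := h3 hX Φ κ hκ hκ1 ε hε
  filter_upwards [e1, e2, e3, eventually_mem_nhdsWithin] with δ hδ1 hδ2 hδ3 hδpos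
  rw [mem_Ioi] at hδpos
  have hmono : PZ.real (zdV (drawP δ) Φ (1 + κ) (1 - κ) (1 + κ)) ≤
      (bondPercolation (zdGraph 2) half).real
        (openCrossing {x : Site 2 | meshPoint δ x ∈ cthickening r Q.carrier}
          {x | meshPoint δ x ∈ cthickening r (Q.arc 0)} {x | meshPoint δ x ∈ cthickening r (Q.arc 2)}) :=
    measureReal_mono (hcont δ hδpos)
  linarith [hδ3.1, hδ3.2]


/-! ## The deterministic cores (to be registered as stubs / landed as Literature lemmas) -/

/-- Window hypothesis on `ℤ²`: no primal-open and no dual-open arm from `B̄(0, W₀)` to distance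
`W₁` (tree events `annulusOpenCrossing`, `annulusDualCrossing`). [folklore] -/
def ZdWindowGood (δ W₀ W₁ : ℝ) (ω : BondConfig (Site 2)) : Prop :=
  ω ∉ annulusOpenCrossing 0 δ W₀ W₁ ∧ ω ∉ annulusDualCrossing 0 δ W₀ W₁

/-- Window hypothesis on `𝕋`: no open and no closed arm from `B(0, W₀)` to distance `W₁`
(tree event `triAnnulusCrossing`). [folklore] -/
def TriWindowGood (δ W₀ W₁ : ℝ) (ω : SiteConfig (Site 2)) : Prop :=
  ω ∉ triAnnulusCrossing true δ 0 W₀ W₁ ∧ ω ∉ triAnnulusCrossing false δ 0 W₀ W₁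

/-- **G1 — planar duality with room for plate events on `ℤ²`** (four forms: no primal/dual
vertical crossing ⇒ dual/primal horizontal crossing spanning the plate inside the zone gap, and
the transposed forms).  Intended proof: continuum quad duality
(`QuadCrossing.Quad.exists_path_avoiding_of_not_exists_isCrossing`) in the quad
`Φ([-(x-ν), x-ν] × [-(yin+ν), yin+ν])` (`exists_quad_of_chart`), lattice shadows
(`openConnIn_of_isPreconnected_subset_openEdgeUnion`, `DualFaceChains.exists_dualConfig_openConnIn_of_path`
and its primal twin), chart room `δ ≤ ρ(Φ, ν)`. [folklore] -/
def ZdPlateDuality : Prop :=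
  ∀ (Φ : ℂ ≃ₜ ℂ) (ν : ℝ), 0 < ν → ∃ δ₀ : ℝ, 0 < δ₀ ∧ ∀ δ : ℝ, 0 < δ → δ ≤ δ₀ →
    ∀ ω : BondConfig (Site 2), ω ⊆ (zdGraph 2).edgeSet →
      (∀ x yin yout : ℝ, 2 * ν < x → x ≤ 2 → 0 < yin → yin + 2 * ν ≤ yout → yout ≤ 2 →
        (ω ∉ zdV (drawP δ) Φ x yin yout → dualConfig ω ∈ zdH (drawD δ) Φ (x - 2 * ν) x (yin + 2 * ν)) ∧
        (dualConfig ω ∉ zdV (drawD δ) Φ x yin yout → ω ∈ zdH (drawP δ) Φ (x - 2 * ν) x (yin + 2 * ν))) ∧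
      (∀ xin xout y : ℝ, 2 * ν < y → y ≤ 2 → 0 < xin → xin + 2 * ν ≤ xout → xout ≤ 2 →
        (ω ∉ zdH (drawP δ) Φ xin xout y → dualConfig ω ∈ zdV (drawD δ) Φ (xin + 2 * ν) (y - 2 * ν) y) ∧
        (dualConfig ω ∉ zdH (drawD δ) Φ xin xout y → ω ∈ zdV (drawP δ) Φ (xin + 2 * ν) (y - 2 * ν) y))

/-- **G2 — planar duality with room for plate events on `𝕋`** (open/closed; four forms).
Intended proof: as G1 with the continuum duality for a general obstacle
(`Quad.exists_path_avoiding_of_not_crossed`, obstacle = drawn closed hexagons of the open sites)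
or through Bollobás–Riordan's Lemma 5 for marked discrete domains
(`tri_markedDomain_duality_holds`) built on the chart quad. [folklore] -/
def TriPlateDuality : Prop :=
  ∀ (Φ : ℂ ≃ₜ ℂ) (ν : ℝ), 0 < ν → ∃ δ₀ : ℝ, 0 < δ₀ ∧ ∀ δ : ℝ, 0 < δ → δ ≤ δ₀ →
    ∀ ω : SiteConfig (Site 2),
      (∀ x yin yout : ℝ, 2 * ν < x → x ≤ 2 → 0 < yin → yin + 2 * ν ≤ yout → yout ≤ 2 →
        (ω ∉ triV Φ δ x yin yout → ωᶜ ∈ triH Φ δ (x - 2 * ν) x (yin + 2 * ν)) ∧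
        (ωᶜ ∉ triV Φ δ x yin yout → ω ∈ triH Φ δ (x - 2 * ν) x (yin + 2 * ν))) ∧
      (∀ xin xout y : ℝ, 2 * ν < y → y ≤ 2 → 0 < xin → xin + 2 * ν ≤ xout → xout ≤ 2 →
        (ω ∉ triH Φ δ xin xout y → ωᶜ ∈ triV Φ δ (xin + 2 * ν) (y - 2 * ν) y) ∧
        (ωᶜ ∉ triH Φ δ xin xout y → ω ∈ triV Φ δ (xin + 2 * ν) (y - 2 * ν) y))

/-- **B1 — plus-position blocking on `ℤ²`**: a primal plate crossing and a dual plate crossing in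
plus position (each spanning beyond the other's plate) cannot coexist (crossing lemma in the
chart + `openEdgeUnion δ ω ∩ dual open edge union = ∅`). [folklore] -/
def ZdPlusBlocking : Prop :=
  ∀ (Φ : ℂ ≃ₜ ℂ) (ν : ℝ), 0 < ν → ∃ δ₀ : ℝ, 0 < δ₀ ∧ ∀ δ : ℝ, 0 < δ → δ ≤ δ₀ →
    ∀ (x yin yout xin xout y : ℝ), 0 < x → x + ν ≤ xin → xin ≤ xout → xout ≤ 2 →
      0 < y → y + ν ≤ yin → yin ≤ yout → yout ≤ 2 →
      ∀ ω : BondConfig (Site 2), ω ⊆ (zdGraph 2).edgeSet →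
        (ω ∈ zdV (drawP δ) Φ x yin yout → dualConfig ω ∈ zdH (drawD δ) Φ xin xout y → False) ∧
        (ω ∈ zdH (drawP δ) Φ xin xout y → dualConfig ω ∈ zdV (drawD δ) Φ x yin yout → False)

/-- **B2 — plus-position blocking on `𝕋`**: an open plate crossing and a closed plate crossing in
plus position cannot coexist (crossing lemma + planarity of the straight-line `𝕋`:
`disjoint_segment_triWalkTrace`-type facts). [folklore] -/
def TriPlusBlocking : Prop :=
  ∀ (Φ : ℂ ≃ₜ ℂ) (ν : ℝ), 0 < ν → ∃ δ₀ : ℝ, 0 < δ₀ ∧ ∀ δ : ℝ, 0 < δ → δ ≤ δ₀ →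
    ∀ (x yin yout xin xout y : ℝ), 0 < x → x + ν ≤ xin → xin ≤ xout → xout ≤ 2 →
      0 < y → y + ν ≤ yin → yin ≤ yout → yout ≤ 2 →
      ∀ ω : SiteConfig (Site 2),
        (ω ∈ triV Φ δ x yin yout → ωᶜ ∈ triH Φ δ xin xout y → False) ∧
        (ω ∈ triH Φ δ xin xout y → ωᶜ ∈ triV Φ δ x yin yout → False)

/-- **B2' — a horizontal `𝕋` plate crossing spanning `Q` blocks the G02 crossings of `Q` of the
other colour** (square model coordinates; Newman / crossing lemma). [folklore] -/
def TriPlateBlocksG02 : Prop :=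
  ∀ (Q : ConformalRectangle) (Φ : ℂ ≃ₜ ℂ), IsSquareModel Q Φ → ∀ ν : ℝ, 0 < ν →
    ∃ δ₀ : ℝ, 0 < δ₀ ∧ ∀ δ : ℝ, 0 < δ → δ ≤ δ₀ →
      ∀ (xin xout y : ℝ), 1 + ν ≤ xin → xin ≤ xout → xout ≤ 2 → 0 < y → y + ν ≤ 1 →
        ∀ ω : SiteConfig (Site 2),
          (ω ∈ triH Φ δ xin xout y → ωᶜ ∈ triCrossing Q.carrier δ (Q.arc 0) (Q.arc 2) → False) ∧
          (ωᶜ ∈ triH Φ δ xin xout y → ω ∈ triCrossing Q.carrier δ (Q.arc 0) (Q.arc 2) → False)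

/-- **T1 — vertical loop sub-arcs transfer from `𝕋` to `ℤ²`** (deterministic, two configurations):
under `IsClose η` of the two typed loop configurations and the two window hypotheses, an open AND a
closed vertical plate crossing of the SAME plate on `𝕋` force the absence of every monochromatic
horizontal plate crossing on `ℤ²` of any plate whose zones lie `c` beyond the `𝕋` plate's width
and whose height is `c` below its zones (`c ≫ η ≫ δ`).  Mechanism: the interface loop through the
last exit edge of a shortest `𝕋`-path from the open chain to the closed chain separates them
(`loopWind` bookkeeping: `loopWind_triMeshPoint_eq_of_chain`, jump across the crossed edge); its
trace ∩ the strip between the chains contains a parameter sub-arc joining the two zone lines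
(simple hexagonal loops; continuum crossing lemma); `udist ≤ η` moves the sub-arc
(`Curve.exists_orientation_shift_reparam_forall_dist_lt`); the primal chain on the left and the dual
chain on the right of the partner's stretch (`IsInterfaceLoop.reachable_left`,
`reachable_cFace_iterate_nextCorner`, localised) are vertical plate crossings of both types, which
block (B1). [folklore] -/
def TransferVerticalTtoZ : Prop :=
  ∀ (Φ : ℂ ≃ₜ ℂ) (c : ℝ), 0 < c → ∃ η₀ : ℝ, 0 < η₀ ∧ ∀ η : ℝ, 0 < η → η ≤ η₀ →
    ∃ δ₀ : ℝ, 0 < δ₀ ∧ ∀ δ : ℝ, 0 < δ → δ ≤ δ₀ →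
      ∀ (W₀ W₁ : ℝ), Φ '' pbox 2 2 ⊆ closedBall (0 : ℂ) W₀ → W₀ < W₁ → W₁ + 1 ≤ 1 / η →
      ∀ (x yin yout : ℝ), c ≤ x → x + c ≤ 2 → c ≤ yin → yin ≤ yout → yout ≤ 2 →
      ∀ (ω : BondConfig (Site 2)) (ω' : SiteConfig (Site 2)), ω ⊆ (zdGraph 2).edgeSet →
        LoopConfig.IsClose η (bondLoopConfig δ 0 ω) (siteLoopConfig δ ω') →
        ZdWindowGood δ W₀ W₁ ω → TriWindowGood δ W₀ W₁ ω' →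
        ω' ∈ triV Φ δ x yin yout → ω'ᶜ ∈ triV Φ δ x yin yout →
        ∀ xout : ℝ, ω ∉ zdMH Φ δ (x + c) xout (yin - c)

/-- **T2 — horizontal loop sub-arcs transfer from `ℤ²` to `𝕋`**: under the same coupling/window
hypotheses, a primal AND a dual horizontal plate crossing of the same plate on `ℤ²` force the
absence of every monochromatic vertical plate crossing on `𝕋` of any plate `c`-narrower than the
`ℤ²` zones and with zones `c` above the `ℤ²` plate height.  Mechanism as T1 with the lattices
exchanged; the sub-arc extraction is on the SELF-TOUCHING medial polylines of `ℤ²` (go through the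
corner-rounded simple loop, or extract the stretch combinatorially), the blocking on `𝕋` (B2).
[folklore] -/
def TransferHorizontalZtoT : Prop :=
  ∀ (Φ : ℂ ≃ₜ ℂ) (c : ℝ), 0 < c → ∃ η₀ : ℝ, 0 < η₀ ∧ ∀ η : ℝ, 0 < η → η ≤ η₀ →
    ∃ δ₀ : ℝ, 0 < δ₀ ∧ ∀ δ : ℝ, 0 < δ → δ ≤ δ₀ →
      ∀ (W₀ W₁ : ℝ), Φ '' pbox 2 2 ⊆ closedBall (0 : ℂ) W₀ → W₀ < W₁ → W₁ + 1 ≤ 1 / η →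
      ∀ (xin xout y : ℝ), 2 * c ≤ xin → xin ≤ xout → xout ≤ 2 → c ≤ y → y + c ≤ 2 →
      ∀ (ω : BondConfig (Site 2)) (ω' : SiteConfig (Site 2)), ω ⊆ (zdGraph 2).edgeSet →
        LoopConfig.IsClose η (bondLoopConfig δ 0 ω) (siteLoopConfig δ ω') →
        ZdWindowGood δ W₀ W₁ ω → TriWindowGood δ W₀ W₁ ω' →
        ω ∈ zdH (drawP δ) Φ xin xout y → dualConfig ω ∈ zdH (drawD δ) Φ xin xout y →
        ∀ yout' : ℝ, ω' ∉ triMV Φ δ (xin - c) (y + c) yout'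

/-! ## Chart room: uniform continuity of the square model on a big box -/

/-- `plateBox`-style boxes are compact. [folklore] -/
theorem isCompact_pbox (x y : ℝ) : IsCompact (pbox x y) :=
  isCompact_Icc.reProdIm isCompact_Icc

/-- **Chart room, forward**: on the box `pbox 2 2` the chart is uniformly continuous — for every
`ν > 0` there is `ρ > 0` such that points of the box at distance `≤ ρ` have images at distance
`≤ ν`. [folklore] -/
theorem exists_chart_room (Φ : ℂ ≃ₜ ℂ) {ν : ℝ} (hν : 0 < ν) :
    ∃ ρ : ℝ, 0 < ρ ∧ ∀ z ∈ pbox 2 2, ∀ w ∈ pbox 2 2, dist z w ≤ ρ → dist (Φ z) (Φ w) ≤ ν := by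
  have huc : UniformContinuousOn Φ (pbox 2 2) :=
    (isCompact_pbox 2 2).uniformContinuousOn_of_continuous Φ.continuous.continuousOn
  obtain ⟨ρ, hρ, h⟩ := Metric.uniformContinuousOn_iff_le.1 huc ν hν
  exact ⟨ρ, hρ, h⟩

/-- Clamping a real into `[-1, 1]`. [folklore] -/
def clamp1 (t : ℝ) : ℝ := max (-1) (min 1 t)

theorem clamp1_mem (t : ℝ) : clamp1 t ∈ Icc (-1 : ℝ) 1 :=
  ⟨le_max_left _ _, max_le (by norm_num) (min_le_left _ _)⟩

theorem abs_sub_clamp1_le {t κ : ℝ} (hκ : 0 ≤ κ) (ht : t ∈ Icc (-(1 + κ)) (1 + κ)) : |t - clamp1 t| ≤ κ := by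
  unfold clamp1
  rcases le_total t 1 with h1 | h1
  · rw [min_eq_right h1]
    rcases le_total (-1) t with h2 | h2
    · rw [max_eq_right h2, sub_self, abs_zero]; exact hκ
    · rw [max_eq_left h2, abs_of_nonpos (by linarith)]; linarith [ht.1]
  · rw [min_eq_left h1, max_eq_right (by norm_num : (-1 : ℝ) ≤ 1), abs_of_nonneg (by linarith)]
    linarith [ht.2]

/-- The distance of two complex numbers is at most the sum of the coordinate distances. [folklore] -/
theorem dist_le_abs_re_add_abs_im (z w : ℂ) : dist z w ≤ |z.re - w.re| + |z.im - w.im| := by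
  rw [dist_eq_norm]
  refine (norm_le_abs_re_add_abs_im (z - w)).trans ?_
  rw [sub_re, sub_im]

/-- A point of `pbox (1+κ) (1+κ)` is within `2κ` of the clamped point of `pbox 1 1`. [folklore] -/
theorem dist_clamp_le {κ : ℝ} (hκ : 0 ≤ κ) {z : ℂ} (hz : z ∈ pbox (1 + κ) (1 + κ)) :
    dist z ⟨clamp1 z.re, clamp1 z.im⟩ ≤ 2 * κ := by
  refine (dist_le_abs_re_add_abs_im _ _).trans ?_
  have h1 := abs_sub_clamp1_le hκ hz.1
  have h2 := abs_sub_clamp1_le hκ hz.2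
  change |z.re - clamp1 z.re| + |z.im - clamp1 z.im| ≤ 2 * κ
  linarith

/-- **S0 holds**: the primal vertical plate event of `P₂ = (1+κ, 1-κ, 1+κ)` is contained in the
bond plate-path event of `(Q, r)`, for `κ` small in terms of the chart room of `r`. [folklore] -/
theorem plateContainment_holds : PlateContainment := by
  intro Q Φ hΦ r hr
  obtain ⟨ρ, hρ, hroom⟩ := exists_chart_room Φ hr
  -- κ with 2κ ≤ ρ and κ ≤ 1/2
  set κ : ℝ := min (ρ / 2) (1 / 2) with hκdef
  have hκ : 0 < κ := lt_min (by positivity) (by norm_num)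
  have hκρ : 2 * κ ≤ ρ := by
    have : κ ≤ ρ / 2 := min_le_left _ _
    linarith
  have hκ1 : κ ≤ 1 / 2 := min_le_right _ _
  refine ⟨κ, hκ, hκ1, fun δ _ => ?_⟩
  -- the two box inclusions used below
  have hbig : pbox (1 + κ) (1 + κ) ⊆ pbox 2 2 := by
    intro z hz
    exact ⟨⟨by linarith [hz.1.1], by linarith [hz.1.2]⟩, ⟨by linarith [hz.2.1], by linarith [hz.2.2]⟩⟩
  have hsmall : pbox 1 1 ⊆ pbox 2 2 := by
    intro z hz
    exact ⟨⟨by linarith [hz.1.1], by linarith [hz.1.2]⟩, ⟨by linarith [hz.2.1], by linarith [hz.2.2]⟩⟩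
  -- plate points are `r`-close to the closed quad
  have hplate : ∀ w : Site 2, meshPoint δ w ∈ Φ '' pbox (1 + κ) (1 + κ) →
      meshPoint δ w ∈ cthickening r Q.carrier := by
    rintro w ⟨z, hz, hzw⟩
    set z' : ℂ := ⟨clamp1 z.re, clamp1 z.im⟩ with hz'
    have hz'mem : z' ∈ pbox 1 1 := ⟨clamp1_mem _, clamp1_mem _⟩
    have hd : dist (Φ z) (Φ z') ≤ r :=
      hroom z (hbig hz) z' (hsmall hz'mem) ((dist_clamp_le hκ.le hz).trans hκρ)
    have hΦz' : Φ z' ∈ closure Q.carrier := by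
      rw [← hΦ.image_Icc]; exact mem_image_of_mem Φ hz'mem
    rw [← cthickening_closure, ← hzw]
    exact mem_cthickening_of_dist_le (Φ z) (Φ z') r _ hΦz' hd
  -- zone points are `r`-close to the corresponding arc
  have hzone0 : ∀ w : Site 2, meshPoint δ w ∈ Φ '' pbox (1 + κ) (1 + κ) →
      meshPoint δ w ∈ Φ '' {z : ℂ | z.im ≤ -(1 - κ)} → meshPoint δ w ∈ cthickening r (Q.arc 0) := by
    rintro w ⟨z, hz, hzw⟩ ⟨z₂, hz₂, hz₂w⟩
    have hzz : z₂ = z := Φ.injective (hz₂w.trans hzw.symm)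
    subst hzz
    set z' : ℂ := ⟨clamp1 z₂.re, -1⟩ with hz'
    have hz'arc : z' ∈ unitSquareQuad.arc 0 := SquareModel.mem_arc_zero.2 ⟨rfl, clamp1_mem _⟩
    have hz'box : z' ∈ pbox 2 2 := ⟨⟨by linarith [(clamp1_mem z₂.re).1], by linarith [(clamp1_mem z₂.re).2]⟩,
      ⟨by norm_num, by norm_num⟩⟩
    have hdz : dist z₂ z' ≤ 2 * κ := by
      refine (dist_le_abs_re_add_abs_im _ _).trans ?_
      have h1 := abs_sub_clamp1_le hκ.le hz.1
      have him1 : z₂.im ≤ -(1 - κ) := hz₂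
      have him2 : -(1 + κ) ≤ z₂.im := hz.2.1
      have h2 : |z₂.im - (-1)| ≤ κ := by rw [abs_le]; constructor <;> linarith
      change |z₂.re - clamp1 z₂.re| + |z₂.im - (-1)| ≤ 2 * κ
      linarith
    have hd : dist (Φ z₂) (Φ z') ≤ r := hroom z₂ (hbig hz) z' hz'box (hdz.trans hκρ)
    have hΦz' : Φ z' ∈ Q.arc 0 := by rw [← hΦ.image_arc 0]; exact mem_image_of_mem Φ hz'arc
    rw [← hz₂w]
    exact mem_cthickening_of_dist_le (Φ z₂) (Φ z') r _ hΦz' hd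
  have hzone2 : ∀ w : Site 2, meshPoint δ w ∈ Φ '' pbox (1 + κ) (1 + κ) →
      meshPoint δ w ∈ Φ '' {z : ℂ | 1 - κ ≤ z.im} → meshPoint δ w ∈ cthickening r (Q.arc 2) := by
    rintro w ⟨z, hz, hzw⟩ ⟨z₂, hz₂, hz₂w⟩
    have hzz : z₂ = z := Φ.injective (hz₂w.trans hzw.symm)
    subst hzz
    set z' : ℂ := ⟨clamp1 z₂.re, 1⟩ with hz'
    have hz'arc : z' ∈ unitSquareQuad.arc 2 := SquareModel.mem_arc_two.2 ⟨rfl, clamp1_mem _⟩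
    have hz'box : z' ∈ pbox 2 2 := ⟨⟨by linarith [(clamp1_mem z₂.re).1], by linarith [(clamp1_mem z₂.re).2]⟩,
      ⟨by norm_num, by norm_num⟩⟩
    have hdz : dist z₂ z' ≤ 2 * κ := by
      refine (dist_le_abs_re_add_abs_im _ _).trans ?_
      have h1 := abs_sub_clamp1_le hκ.le hz.1
      have him1 : 1 - κ ≤ z₂.im := hz₂
      have him2 : z₂.im ≤ 1 + κ := hz.2.2
      have h2 : |z₂.im - 1| ≤ κ := by rw [abs_le]; constructor <;> linarith
      change |z₂.re - clamp1 z₂.re| + |z₂.im - 1| ≤ 2 * κ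
      linarith
    have hd : dist (Φ z₂) (Φ z') ≤ r := hroom z₂ (hbig hz) z' hz'box (hdz.trans hκρ)
    have hΦz' : Φ z' ∈ Q.arc 2 := by rw [← hΦ.image_arc 2]; exact mem_image_of_mem Φ hz'arc
    rw [← hz₂w]
    exact mem_cthickening_of_dist_le (Φ z₂) (Φ z') r _ hΦz' hd
  -- the inclusion of events
  rintro ω ⟨u, hu, v, hv, hconn⟩
  have huS : meshPoint δ u ∈ Φ '' pbox (1 + κ) (1 + κ) := hconn.1
  have hvS : meshPoint δ v ∈ Φ '' pbox (1 + κ) (1 + κ) := hconn.2.1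
  exact ⟨u, hzone0 u huS hu, v, hzone2 v hvS hv, openConnIn_mono (fun w hw => hplate w hw) u v hconn⟩

/-! ## Reductions of S1, S2, S3 to the cores (lead; to be completed) -/

/-- Harder vertical plates have smaller events (local copy of `zdPlateV_mono`). [folklore] -/
theorem zdV_mono' (draw : Site 2 → ℂ) (Φ : ℂ ≃ₜ ℂ) {x x' yin yin' yout yout' : ℝ}
    (hx : x ≤ x') (hyin : yin' ≤ yin) (hyout : yout ≤ yout') :
    zdV draw Φ x yin yout ⊆ zdV draw Φ x' yin' yout' := by
  have hbox : pbox x yout ⊆ pbox x' yout' := fun z hz =>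
    ⟨Icc_subset_Icc (neg_le_neg hx) hx hz.1, Icc_subset_Icc (neg_le_neg hyout) hyout hz.2⟩
  have hlo : {z : ℂ | z.im ≤ -yin} ⊆ {z : ℂ | z.im ≤ -yin'} := fun z hz => le_trans hz (neg_le_neg hyin)
  have hhi : {z : ℂ | yin ≤ z.im} ⊆ {z : ℂ | yin' ≤ z.im} := fun z hz => le_trans hyin hz
  exact openCrossing_mono (fun w hw => image_mono hbox hw) (fun w hw => image_mono hlo hw)
    (fun w hw => image_mono hhi hw)


/-- Plate/zone events on `ℤ²` are measurable (countable vertex type). [folklore] -/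
theorem measurableSet_openCrossing_site' (S A B : Set (Site 2)) :
    MeasurableSet (openCrossing S A B : Set (BondConfig (Site 2))) := by
  have h : openCrossing S A B = ⋃ x ∈ A, ⋃ y ∈ B, (openConnIn S x y : Set (BondConfig (Site 2))) := by
    ext ω
    simp only [mem_openCrossing_iff, Set.mem_iUnion, exists_prop]
  rw [h]
  exact MeasurableSet.biUnion (Set.to_countable A) fun x _ =>
    MeasurableSet.biUnion (Set.to_countable B) fun y _ => measurableSet_openConnIn_of_countable S x y

/-- **Chart room, backward**: for every `ν > 0` there is `ρ ∈ (0, 1]` such that a point within `ρ`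
of the image of a point of `pbox 2 2` pulls back to within `ν` of it. [folklore] -/
theorem exists_chart_room_symm (Φ : ℂ ≃ₜ ℂ) {ν : ℝ} (hν : 0 < ν) :
    ∃ ρ : ℝ, 0 < ρ ∧ ρ ≤ 1 ∧ ∀ z ∈ pbox 2 2, ∀ p : ℂ, dist p (Φ z) ≤ ρ → dist (Φ.symm p) z ≤ ν := by
  set K : Set ℂ := cthickening 1 (Φ '' pbox 2 2) with hK
  have hKc : IsCompact K := ((isCompact_pbox 2 2).image Φ.continuous).cthickening
  have huc : UniformContinuousOn Φ.symm K := hKc.uniformContinuousOn_of_continuous Φ.symm.continuous.continuousOn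
  obtain ⟨ρ, hρ, h⟩ := Metric.uniformContinuousOn_iff_le.1 huc ν hν
  refine ⟨min ρ 1, lt_min hρ one_pos, min_le_right _ _, fun z hz p hp => ?_⟩
  have hΦz : Φ z ∈ K := self_subset_cthickening _ (mem_image_of_mem Φ hz)
  have hpK : p ∈ K := mem_cthickening_of_dist_le p (Φ z) 1 _ (mem_image_of_mem Φ hz) (hp.trans (min_le_right _ _))
  have := h p hpK (Φ z) hΦz (hp.trans (min_le_left _ _))
  rwa [Homeomorph.symm_apply_apply] at this

/-- The dual drawing is within `δ` of the primal drawing (`δ ≥ 0`). [folklore] -/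
theorem dist_drawD_drawP_le {δ : ℝ} (hδ : 0 ≤ δ) (w : Site 2) : dist (drawD δ w) (drawP δ w) ≤ δ := by
  change dist (dualScale δ (Site.toComplex w)) (meshPoint δ w) ≤ δ
  rw [dualScale_toComplex, dist_eq_norm, add_sub_cancel_left, norm_mul, Complex.norm_real, Real.norm_of_nonneg hδ]
  have hoff : ‖dualOffset‖ ≤ 1 := by
    refine (norm_le_abs_re_add_abs_im _).trans ?_
    have hre : dualOffset.re = 1 / 2 := rfl
    have him : dualOffset.im = 1 / 2 := rfl
    rw [hre, him]; norm_num
  calc δ * ‖dualOffset‖ ≤ δ * 1 := by gcongr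
    _ = δ := mul_one δ

/-- Transfer of "drawn by `drawD` inside `Φ(S)`" to "drawn by `drawP` inside `Φ(S')`" when `S'`
contains the `ν`-box-neighbourhood of `S ⊆ pbox 2 2` and `δ ≤ ρ`. [folklore] -/
theorem drawP_mem_image_of_drawD_mem {Φ : ℂ ≃ₜ ℂ} {ν ρ δ : ℝ} (hδ : 0 ≤ δ) (hδρ : δ ≤ ρ)
    (hroom : ∀ z ∈ pbox 2 2, ∀ p : ℂ, dist p (Φ z) ≤ ρ → dist (Φ.symm p) z ≤ ν)
    {S S' : Set ℂ} (hS : S ⊆ pbox 2 2) (hSS' : ∀ z ∈ S, ∀ z' : ℂ, dist z' z ≤ ν → z' ∈ S')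
    {w : Site 2} (hw : drawD δ w ∈ Φ '' S) : drawP δ w ∈ Φ '' S' := by
  obtain ⟨z, hz, hzw⟩ := hw
  refine ⟨Φ.symm (drawP δ w), hSS' z hz _ (hroom z (hS hz) _ ?_), Φ.apply_symm_apply _⟩
  rw [hzw, dist_comm]
  exact (dist_drawD_drawP_le hδ w).trans hδρ

/-- S1 from G1 (ℤ² plate duality) + exact bond self-duality + inclusions. [folklore] -/
theorem polarZ_of (hG1 : ZdPlateDuality) : PolarZ := by
  intro Φ κ hκ hκ1
  -- room for the duality and for the dual shift
  have hν : 0 < κ / 10 := by positivity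
  obtain ⟨δ₁, hδ₁, hdual⟩ := hG1 Φ (κ / 10) hν
  obtain ⟨ρ, hρ, hρ1, hroom⟩ := exists_chart_room_symm Φ hν
  have hev : ∀ᶠ δ : ℝ in 𝓝[>] 0, δ ∈ Ioo 0 (min δ₁ ρ) := Ioo_mem_nhdsGT (lt_min hδ₁ hρ)
  filter_upwards [hev] with δ hδ
  have hδpos : 0 < δ := hδ.1
  have hδ₁' : δ ≤ δ₁ := (hδ.2.trans_le (min_le_left _ _)).le
  have hδρ : δ ≤ ρ := (hδ.2.trans_le (min_le_right _ _)).le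
  -- the four events
  set A : Set (BondConfig (Site 2)) := zdV (drawP δ) Φ (1 + 4 * κ / 5) (1 - 4 * κ / 5) (1 + 4 * κ / 5) with hA
  set E : Set (BondConfig (Site 2)) := zdV (drawD δ) Φ (1 + 4 * κ / 5) (1 - 4 * κ / 5) (1 + 4 * κ / 5) with hE
  set B : Set (BondConfig (Site 2)) := dualConfig ⁻¹' E with hB
  set V₂ : Set (BondConfig (Site 2)) := zdV (drawP δ) Φ (1 + κ) (1 - κ) (1 + κ) with hV₂
  set Hm : Set (BondConfig (Site 2)) := zdMH Φ δ (1 + 3 * κ / 5) (1 + 4 * κ / 5) (1 - 3 * κ / 5) with hHm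
  have hAm : MeasurableSet A := measurableSet_openCrossing_site' _ _ _
  have hEm : MeasurableSet E := measurableSet_openCrossing_site' _ _ _
  have hBm : MeasurableSet B := measurable_dualConfig hEm
  have hHmm : MeasurableSet Hm :=
    (measurableSet_openCrossing_site' _ _ _).union (measurable_dualConfig (measurableSet_openCrossing_site' _ _ _))
  -- (1) A ⊆ V₂
  have h1 : A ⊆ V₂ := zdV_mono' (drawP δ) Φ (by linarith) (by linarith) (by linarith)
  -- (2) E ⊆ V₂ (dual drawing inside the smaller plate ⇒ primal drawing inside the bigger one)
  have hboxsub : pbox (1 + 4 * κ / 5) (1 + 4 * κ / 5) ⊆ pbox 2 2 := fun z hz =>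
    ⟨⟨by linarith [hz.1.1], by linarith [hz.1.2]⟩, ⟨by linarith [hz.2.1], by linarith [hz.2.2]⟩⟩
  have hgrow : ∀ z ∈ pbox (1 + 4 * κ / 5) (1 + 4 * κ / 5), ∀ z' : ℂ, dist z' z ≤ κ / 10 →
      z' ∈ pbox (1 + κ) (1 + κ) := by
    intro z hz z' hd
    have hre : |z'.re - z.re| ≤ κ / 10 := (abs_re_le_norm (z' - z)).trans (by rwa [← dist_eq_norm])
    have him : |z'.im - z.im| ≤ κ / 10 := (abs_im_le_norm (z' - z)).trans (by rwa [← dist_eq_norm])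
    rw [abs_le] at hre him
    exact ⟨⟨by linarith [hz.1.1], by linarith [hz.1.2]⟩, ⟨by linarith [hz.2.1], by linarith [hz.2.2]⟩⟩
  have h2 : E ⊆ V₂ := by
    rintro ω ⟨u, hu, v, hv, hconn⟩
    have huS : drawD δ u ∈ Φ '' pbox (1 + 4 * κ / 5) (1 + 4 * κ / 5) := hconn.1
    have hvS : drawD δ v ∈ Φ '' pbox (1 + 4 * κ / 5) (1 + 4 * κ / 5) := hconn.2.1
    -- zones together with the plate
    have huZ : drawP δ u ∈ Φ '' {z : ℂ | z.im ≤ -(1 - κ)} := by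
      obtain ⟨z, hz, hzu⟩ := huS
      obtain ⟨z₂, hz₂, hz₂u⟩ := hu
      have : z₂ = z := Φ.injective (hz₂u.trans hzu.symm)
      subst this
      refine ⟨Φ.symm (drawP δ u), ?_, Φ.apply_symm_apply _⟩
      have hd : dist (Φ.symm (drawP δ u)) z₂ ≤ κ / 10 := hroom z₂ (hboxsub hz) _ (by
        rw [hz₂u, dist_comm]; exact (dist_drawD_drawP_le hδpos.le u).trans hδρ)
      have him : |(Φ.symm (drawP δ u)).im - z₂.im| ≤ κ / 10 :=
        (abs_im_le_norm (Φ.symm (drawP δ u) - z₂)).trans (by rwa [← dist_eq_norm])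
      rw [abs_le] at him
      have hz₂' : z₂.im ≤ -(1 - 4 * κ / 5) := hz₂
      show (Φ.symm (drawP δ u)).im ≤ -(1 - κ)
      linarith
    have hvZ : drawP δ v ∈ Φ '' {z : ℂ | 1 - κ ≤ z.im} := by
      obtain ⟨z, hz, hzv⟩ := hvS
      obtain ⟨z₂, hz₂, hz₂v⟩ := hv
      have : z₂ = z := Φ.injective (hz₂v.trans hzv.symm)
      subst this
      refine ⟨Φ.symm (drawP δ v), ?_, Φ.apply_symm_apply _⟩
      have hd : dist (Φ.symm (drawP δ v)) z₂ ≤ κ / 10 := hroom z₂ (hboxsub hz) _ (by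
        rw [hz₂v, dist_comm]; exact (dist_drawD_drawP_le hδpos.le v).trans hδρ)
      have him : |(Φ.symm (drawP δ v)).im - z₂.im| ≤ κ / 10 :=
        (abs_im_le_norm (Φ.symm (drawP δ v) - z₂)).trans (by rwa [← dist_eq_norm])
      rw [abs_le] at him
      have hz₂' : 1 - 4 * κ / 5 ≤ z₂.im := hz₂
      show 1 - κ ≤ (Φ.symm (drawP δ v)).im
      linarith
    refine ⟨u, huZ, v, hvZ, openConnIn_mono (fun w hw => ?_) u v hconn⟩
    exact drawP_mem_image_of_drawD_mem hδpos.le hδρ hroom hboxsub hgrow hw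
  -- (3) P(B) = P(E)
  have h3 : PZ.real B = PZ.real E := bondPercolation_half_real_preimage_dualConfig hEm
  -- (5) off Hm, both A and B hold (a.e., on lattice configurations)
  have h5 : ∀ ω : BondConfig (Site 2), ω ⊆ (zdGraph 2).edgeSet → ω ∉ Hm → ω ∈ A ∩ B := by
    intro ω hω hnot
    have hH := (hdual δ hδpos hδ₁' ω hω).2 (1 + 3 * κ / 5) (1 + 4 * κ / 5) (1 - 3 * κ / 5)
      (by linarith) (by linarith) (by linarith) (by linarith) (by linarith)
    simp only [hHm, zdMH, mem_union, mem_preimage, not_or] at hnot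
    have e1 : (1 + 3 * κ / 5) + 2 * (κ / 10) = 1 + 4 * κ / 5 := by ring
    have e2 : (1 - 3 * κ / 5) - 2 * (κ / 10) = 1 - 4 * κ / 5 := by ring
    constructor
    · have hd := hH.2 hnot.2
      rw [e1, e2] at hd
      exact zdV_mono' (drawP δ) Φ le_rfl le_rfl (by linarith) hd
    · have hd := hH.1 hnot.1
      rw [e1, e2] at hd
      exact zdV_mono' (drawD δ) Φ le_rfl le_rfl (by linarith) hd
  have h5' : PZ.real Hmᶜ ≤ PZ.real (A ∩ B) := by
    simp only [measureReal_def]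
    refine ENNReal.toReal_mono (measure_ne_top _ _) (measure_mono_ae ?_)
    filter_upwards [ae_subset_edgeSet (zdGraph 2) half] with ω hω
    intro hc
    exact h5 ω hω hc
  -- assemble
  have hunion : PZ.real (A ∪ B) + PZ.real (A ∩ B) = PZ.real A + PZ.real B :=
    measureReal_union_add_inter hBm
  have hcompl : PZ.real Hmᶜ = 1 - PZ.real Hm := by
    rw [measureReal_compl hHmm, probReal_univ]
  have hA2 : PZ.real A ≤ PZ.real V₂ := measureReal_mono h1
  have hB2 : PZ.real B ≤ PZ.real V₂ := h3 ▸ measureReal_mono h2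
  have hMV : PZ.real (zdMV Φ δ (1 + 4 * κ / 5) (1 - 4 * κ / 5) (1 + 4 * κ / 5)) = PZ.real (A ∪ B) := rfl
  rw [hMV]
  linarith

/-- The image of the big box lies in some closed ball about `0`. [folklore] -/
theorem exists_closedBall_superset (Φ : ℂ ≃ₜ ℂ) : ∃ W₀ : ℝ, 0 < W₀ ∧ Φ '' pbox 2 2 ⊆ closedBall (0 : ℂ) W₀ := by
  obtain ⟨W, hW⟩ := ((isCompact_pbox 2 2).image Φ.continuous).isBounded.subset_closedBall (0 : ℂ)
  exact ⟨max W 1, lt_max_of_lt_right one_pos, hW.trans (closedBall_subset_closedBall (le_max_left _ _))⟩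

/-- A plate site set of `𝕋` is finite (`δ > 0`, plate inside `pbox 2 2`). [folklore] -/
theorem finite_triPlateSites {Φ : ℂ ≃ₜ ℂ} {W₀ : ℝ} (hW : Φ '' pbox 2 2 ⊆ closedBall (0 : ℂ) W₀)
    {δ : ℝ} (hδ : 0 < δ) {S : Set ℂ} (hS : S ⊆ pbox 2 2) :
    {w : Site 2 | triMeshPoint δ w ∈ Φ '' S}.Finite := by
  refine (finite_setOf_dist_triMeshPoint_le hδ 0 W₀).subset fun w hw => ?_
  exact mem_closedBall.1 (hW (image_mono hS hw))

/-- Plate crossing events of `𝕋` are measurable. [folklore] -/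
theorem measurableSet_triPlate {Φ : ℂ ≃ₜ ℂ} {W₀ : ℝ} (hW : Φ '' pbox 2 2 ⊆ closedBall (0 : ℂ) W₀)
    {δ : ℝ} (hδ : 0 < δ) {S : Set ℂ} (hS : S ⊆ pbox 2 2) (A B : Set (Site 2)) :
    MeasurableSet {ω : SiteConfig (Site 2) | ∃ u ∈ A, ∃ v ∈ B,
      ω ∈ siteConnIn triGraph {w | triMeshPoint δ w ∈ Φ '' S} u v} := by
  have hfin := finite_triPlateSites hW hδ hS
  have heq : {ω : SiteConfig (Site 2) | ∃ u ∈ A, ∃ v ∈ B,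
      ω ∈ siteConnIn triGraph {w | triMeshPoint δ w ∈ Φ '' S} u v} =
      ⋃ u ∈ A, ⋃ v ∈ B, siteConnIn triGraph (↑hfin.toFinset) u v := by
    ext ω
    simp only [mem_setOf_eq, mem_iUnion, exists_prop, Finite.coe_toFinset]
  rw [heq]
  exact MeasurableSet.biUnion (to_countable _) fun u _ =>
    MeasurableSet.biUnion (to_countable _) fun v _ => measurableSet_siteConnIn _ _ u v

/-- The G02 crossing event of `𝕋` is measurable (`δ > 0`). [folklore] -/
theorem measurableSet_triCrossing' (R : ConformalRectangle) {δ : ℝ} (hδ : 0 < δ) :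
    MeasurableSet (triCrossing R.carrier δ (R.arc 0) (R.arc 2)) := by
  have hfin : (triMeshDomain R.carrier δ).Finite := triMeshDomain_finite_holds R.isBounded hδ
  have heq : triCrossing R.carrier δ (R.arc 0) (R.arc 2) =
      ⋃ x ∈ triDiscreteArc R.carrier δ (R.arc 0), ⋃ y ∈ triDiscreteArc R.carrier δ (R.arc 2),
        siteConnIn (triDiscreteDomainGraph R.carrier δ) (↑hfin.toFinset) x y := by
    ext ω
    simp only [triCrossing, mem_setOf_eq, mem_iUnion, exists_prop, Finite.coe_toFinset]
  rw [heq]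
  exact MeasurableSet.biUnion (to_countable _) fun x _ ↦
    MeasurableSet.biUnion (to_countable _) fun y _ ↦ measurableSet_siteConnIn _ _ x y

/-- At `p = 1/2` site percolation on `𝕋` is invariant under complementation. [folklore] -/
theorem PT_real_preimage_compl (S : Set (SiteConfig (Site 2))) : PT.real (compl ⁻¹' S) = PT.real S := by
  change (triSitePercolation half).real _ = (triSitePercolation half).real _
  rw [triSitePercolation, sitePercolation_real_preimage_compl, symm_half]

/-- Harder vertical plates have smaller events (`𝕋`, local copy). [folklore] -/
theorem triV_mono' (Φ : ℂ ≃ₜ ℂ) (δ : ℝ) {x x' yin yin' yout yout' : ℝ}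
    (hx : x ≤ x') (hyin : yin' ≤ yin) (hyout : yout ≤ yout') :
    triV Φ δ x yin yout ⊆ triV Φ δ x' yin' yout' := by
  have hbox : pbox x yout ⊆ pbox x' yout' := fun z hz =>
    ⟨Icc_subset_Icc (neg_le_neg hx) hx hz.1, Icc_subset_Icc (neg_le_neg hyout) hyout hz.2⟩
  have hlo : {z : ℂ | z.im ≤ -yin} ⊆ {z : ℂ | z.im ≤ -yin'} := fun z hz => le_trans hz (neg_le_neg hyin)
  have hhi : {z : ℂ | yin ≤ z.im} ⊆ {z : ℂ | yin' ≤ z.im} := fun z hz => le_trans hyin hz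
  rintro ω ⟨u, hu, v, hv, hω⟩
  refine ⟨u, image_mono hlo hu, v, image_mono hhi hv, ?_⟩
  exact siteConnIn_mono_set (G := triGraph) (S := {w | triMeshPoint δ w ∈ Φ '' pbox x yout})
    (T := {w | triMeshPoint δ w ∈ Φ '' pbox x' yout'})
    (fun w hw => (image_mono hbox hw :)) u v hω

/-- Easier horizontal plates have bigger events (`𝕋`, local copy). [folklore] -/
theorem triH_mono' (Φ : ℂ ≃ₜ ℂ) (δ : ℝ) {xin xin' xout xout' y y' : ℝ}
    (hxin : xin' ≤ xin) (hxout : xout ≤ xout') (hy : y ≤ y') :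
    triH Φ δ xin xout y ⊆ triH Φ δ xin' xout' y' := by
  have hbox : pbox xout y ⊆ pbox xout' y' := fun z hz =>
    ⟨Icc_subset_Icc (neg_le_neg hxout) hxout hz.1, Icc_subset_Icc (neg_le_neg hy) hy hz.2⟩
  have hlo : {z : ℂ | z.re ≤ -xin} ⊆ {z : ℂ | z.re ≤ -xin'} := fun z hz => le_trans hz (neg_le_neg hxin)
  have hhi : {z : ℂ | xin ≤ z.re} ⊆ {z : ℂ | xin' ≤ z.re} := fun z hz => le_trans hxin hz
  rintro ω ⟨u, hu, v, hv, hω⟩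
  refine ⟨u, image_mono hlo hu, v, image_mono hhi hv, ?_⟩
  exact siteConnIn_mono_set (G := triGraph) (S := {w | triMeshPoint δ w ∈ Φ '' pbox xout y})
    (T := {w | triMeshPoint δ w ∈ Φ '' pbox xout' y'})
    (fun w hw => (image_mono hbox hw :)) u v hω

/-- S2 from G2 (𝕋 plate duality) + B2' (plate crossings block G02 crossings) + colour flip.
[folklore] -/
theorem polarT_of (hG2 : TriPlateDuality) (hB : TriPlateBlocksG02) : PolarT := by
  intro Q Φ hΦ κ hκ hκ1
  have hν : 0 < κ / 10 := by positivity
  obtain ⟨δ₁, hδ₁, hdual⟩ := hG2 Φ (κ / 10) hν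
  obtain ⟨δ₂, hδ₂, hblock⟩ := hB Q Φ hΦ (κ / 10) hν
  obtain ⟨W₀, hW₀, hW⟩ := exists_closedBall_superset Φ
  have hev : ∀ᶠ δ : ℝ in 𝓝[>] 0, δ ∈ Ioo 0 (min δ₁ δ₂) := Ioo_mem_nhdsGT (lt_min hδ₁ hδ₂)
  filter_upwards [hev] with δ hδ
  have hδpos : 0 < δ := hδ.1
  have hδ₁' : δ ≤ δ₁ := (hδ.2.trans_le (min_le_left _ _)).le
  have hδ₂' : δ ≤ δ₂ := (hδ.2.trans_le (min_le_right _ _)).le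
  -- events
  set Ho : Set (SiteConfig (Site 2)) := triH Φ δ (1 + 3 * κ / 10) (1 + 11 * κ / 20) (1 - 3 * κ / 10) with hHo
  set Hc : Set (SiteConfig (Site 2)) := compl ⁻¹' Ho with hHc
  set G : Set (SiteConfig (Site 2)) := triCrossing Q.carrier δ (Q.arc 0) (Q.arc 2) with hG
  set Gc : Set (SiteConfig (Site 2)) := compl ⁻¹' G with hGc
  set M3 : Set (SiteConfig (Site 2)) := triMV Φ δ (1 + 11 * κ / 20) (1 - 11 * κ / 20) (1 + 11 * κ / 20) with hM3
  set M4 : Set (SiteConfig (Site 2)) := triMV Φ δ (1 + κ / 2) (1 - κ / 2) (1 + κ / 2) with hM4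
  -- measurability
  have hbox₁ : pbox (1 + 11 * κ / 20) (1 - 3 * κ / 10) ⊆ pbox 2 2 := fun z hz =>
    ⟨⟨by linarith [hz.1.1], by linarith [hz.1.2]⟩, ⟨by linarith [hz.2.1], by linarith [hz.2.2]⟩⟩
  have hHom : MeasurableSet Ho := measurableSet_triPlate hW hδpos hbox₁ _ _
  have hcm : Measurable (compl : SiteConfig (Site 2) → SiteConfig (Site 2)) :=
    measurable_set_iff.2 fun i => (measurable_set_mem i).not
  have hHcm : MeasurableSet Hc := hcm hHom
  have hGm : MeasurableSet G := measurableSet_triCrossing' Q hδpos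
  -- (ii) blocking: Ho misses Gc, Hc misses G
  have hbl := hblock δ hδpos hδ₂' (1 + 3 * κ / 10) (1 + 11 * κ / 20) (1 - 3 * κ / 10)
    (by linarith) (by linarith) (by linarith) (by linarith) (by linarith)
  have h2a : Ho ⊆ Gcᶜ := fun ω hω hω' => (hbl ω).1 hω hω'
  have h2b : Hc ⊆ Gᶜ := fun ω hω hω' => (hbl ω).2 hω hω'
  -- (iii) duality: off M4, both Ho and Hc
  have h3 : M4ᶜ ⊆ Ho ∩ Hc := by
    intro ω hω
    simp only [hM4, triMV, mem_compl_iff, mem_union, mem_preimage, not_or] at hω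
    have hd := (hdual δ hδpos hδ₁' ω).1 (1 + κ / 2) (1 - κ / 2) (1 + κ / 2)
      (by linarith) (by linarith) (by linarith) (by linarith) (by linarith)
    have e1 : (1 + κ / 2) - 2 * (κ / 10) = 1 + 3 * κ / 10 := by ring
    have e2 : (1 - κ / 2) + 2 * (κ / 10) = 1 - 3 * κ / 10 := by ring
    constructor
    · -- no closed vertical ⇒ open horizontal
      have h := hd.2 hω.2
      rw [e1, e2] at h
      exact triH_mono' Φ δ le_rfl (by linarith) le_rfl h
    · have h := hd.1 hω.1
      rw [e1, e2] at h
      exact triH_mono' Φ δ le_rfl (by linarith) le_rfl h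
  -- (iv) M4 ⊆ M3
  have h4 : M4 ⊆ M3 := by
    refine union_subset_union (triV_mono' Φ δ (by linarith) (by linarith) (by linarith)) ?_
    exact preimage_mono (triV_mono' Φ δ (by linarith) (by linarith) (by linarith))
  -- probabilities
  have hGc : PT.real Gc = PT.real G := PT_real_preimage_compl G
  have hHc : PT.real Hc = PT.real Ho := PT_real_preimage_compl Ho
  have htri : triDomainCrossingProb Q δ = PT.real G := triDomainCrossingProb_eq_measureReal Q δ
  have hHo_le : PT.real Ho ≤ 1 - PT.real G := by
    have := measureReal_mono (μ := PT) h2a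
    rw [measureReal_compl (hcm hGm), probReal_univ, hGc] at this
    exact this
  have hHc_le : PT.real Hc ≤ 1 - PT.real G := by
    have := measureReal_mono (μ := PT) h2b
    rw [measureReal_compl hGm, probReal_univ] at this
    exact this
  have hunion : PT.real (Ho ∪ Hc) + PT.real (Ho ∩ Hc) = PT.real Ho + PT.real Hc :=
    measureReal_union_add_inter hHcm
  have hinter : 1 - PT.real M3 ≤ PT.real (Ho ∩ Hc) := by
    have h1 : PT.real M4ᶜ ≤ PT.real (Ho ∩ Hc) := measureReal_mono h3
    have h2 : PT.real M4 ≤ PT.real M3 := measureReal_mono h4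
    have h3' : 1 - PT.real M4 ≤ PT.real M4ᶜ := by
      have hle : PT.real (univ : Set (SiteConfig (Site 2))) ≤ PT.real M4 + PT.real M4ᶜ := by
        rw [← union_compl_self M4]
        exact measureReal_union_le _ _
      rw [probReal_univ] at hle
      linarith
    linarith
  have hMH : PT.real (triMH Φ δ (1 + 3 * κ / 10) (1 + 11 * κ / 20) (1 - 3 * κ / 10)) = PT.real (Ho ∪ Hc) := rfl
  rw [hMH, htri]
  linarith

/-- Marginal bound through a coupling of two different spaces, first coordinate. [folklore] -/
theorem measureReal_preimage_fst_le_of_map_eq' {X Y : Type*} [MeasurableSpace X] [MeasurableSpace Y]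
    {P : Measure (X × Y)} {μ : Measure X} [IsFiniteMeasure μ] (h : P.map Prod.fst = μ)
    (s : Set X) : P.real (Prod.fst ⁻¹' s) ≤ μ.real s := by
  have h' : P (Prod.fst ⁻¹' s) ≤ μ s := by
    rw [← h]
    exact Measure.le_map_apply measurable_fst.aemeasurable s
  exact ENNReal.toReal_mono (measure_ne_top μ s) h'

/-- Marginal bound through a coupling of two different spaces, second coordinate. [folklore] -/
theorem measureReal_preimage_snd_le_of_map_eq' {X Y : Type*} [MeasurableSpace X] [MeasurableSpace Y]
    {P : Measure (X × Y)} {ν : Measure Y} [IsFiniteMeasure ν] (h : P.map Prod.snd = ν)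
    (s : Set Y) : P.real (Prod.snd ⁻¹' s) ≤ ν.real s := by
  have h' : P (Prod.snd ⁻¹' s) ≤ ν s := by
    rw [← h]
    exact Measure.le_map_apply measurable_snd.aemeasurable s
  exact ENNReal.toReal_mono (measure_ne_top ν s) h'

/-- For `c > 0` and `ε' > 0` there is `t₀ > 0` with `t ^ c < ε'` for all `t ∈ (0, t₀)`. [folklore] -/
theorem exists_pos_forall_rpow_lt {c ε' : ℝ} (hc : 0 < c) (hε' : 0 < ε') :
    ∃ t₀ : ℝ, 0 < t₀ ∧ ∀ t ∈ Set.Ioo (0 : ℝ) t₀, t ^ c < ε' := by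
  refine ⟨(ε' / 2) ^ (1 / c), Real.rpow_pos_of_pos (by positivity) _, fun t ht => ?_⟩
  have htc : t ^ c ≤ ((ε' / 2) ^ (1 / c)) ^ c := Real.rpow_le_rpow ht.1.le ht.2.le hc.le
  rw [← Real.rpow_mul (by positivity), one_div_mul_cancel hc.ne', Real.rpow_one] at htc
  linarith

/-- **Window confinement** (RSW one-arm bounds of the tree on both lattices): for every `ε > 0`
there are radii `W₀ < W₁` with `Φ(pbox 2 2) ⊆ B̄(0, W₀)` such that, for all small `δ`, a primal or
dual arm of `δℤ²` and an open or closed arm of `δ𝕋` from `B̄(0, W₀)` to distance `W₁` each have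
probability `≤ ε`. [folklore] -/
theorem exists_window (Φ : ℂ ≃ₜ ℂ) {ε : ℝ} (hε : 0 < ε) :
    ∃ W₀ W₁ : ℝ, 0 < W₀ ∧ W₀ < W₁ ∧ Φ '' pbox 2 2 ⊆ closedBall (0 : ℂ) W₀ ∧
      ∃ δw : ℝ, 0 < δw ∧ ∀ δ : ℝ, 0 < δ → δ ≤ δw →
        PZ.real {ω | ¬ ZdWindowGood δ W₀ W₁ ω} ≤ ε ∧ PT.real {ω | ¬ TriWindowGood δ W₀ W₁ ω} ≤ ε := by
  obtain ⟨W₀, hW₀, hW⟩ := exists_closedBall_superset Φ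
  obtain ⟨αO, cO, hαO, hcO, hO⟩ := annulusOpenCrossing_half_le_holds
  obtain ⟨αD, cD, hαD, hcD, hD⟩ := annulusDualCrossing_half_le_holds
  obtain ⟨αT, hαT, hT⟩ := tri_annulusCrossing_bound_holds
  have hε2 : 0 < ε / 2 := by positivity
  obtain ⟨tO, htO, hsmallO⟩ := exists_pos_forall_rpow_lt hαO hε2
  obtain ⟨tD, htD, hsmallD⟩ := exists_pos_forall_rpow_lt hαD hε2
  obtain ⟨tT, htT, hsmallT⟩ := exists_pos_forall_rpow_lt hαT hε2
  set s : ℝ := min (min (tO / 2) (tD / 2)) (min (tT / 2) (1 / 2)) with hsdef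
  have hs : 0 < s := lt_min (lt_min (by positivity) (by positivity)) (lt_min (by positivity) (by norm_num))
  have hsO : s < tO := by
    have : s ≤ tO / 2 := (min_le_left _ _).trans (min_le_left _ _)
    linarith
  have hsD : s < tD := by
    have : s ≤ tD / 2 := (min_le_left _ _).trans (min_le_right _ _)
    linarith
  have hsT : s < tT := by
    have : s ≤ tT / 2 := (min_le_right _ _).trans (min_le_left _ _)
    linarith
  have hs2 : s ≤ 1 / 2 := (min_le_right _ _).trans (min_le_right _ _)
  set W₁ : ℝ := W₀ / s with hW₁def
  have hW₁pos : 0 < W₁ := div_pos hW₀ hs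
  have hratio : W₀ / W₁ = s := by
    rw [hW₁def]
    field_simp
  have h2W : 2 * W₀ ≤ W₁ := by
    rw [hW₁def, le_div_iff₀ hs]
    nlinarith
  have hW₀₁ : W₀ < W₁ := by linarith
  refine ⟨W₀, W₁, hW₀, hW₀₁, hW, min (min (W₀ / cO) (W₀ / cD)) (W₀ / 1000),
    lt_min (lt_min (div_pos hW₀ hcO) (div_pos hW₀ hcD)) (by positivity), fun δ hδ hδle => ?_⟩
  have hδO : cO * δ ≤ W₀ := by
    have : δ ≤ W₀ / cO := hδle.trans ((min_le_left _ _).trans (min_le_left _ _))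
    rwa [le_div_iff₀ hcO, mul_comm] at this
  have hδD : cD * δ ≤ W₀ := by
    have : δ ≤ W₀ / cD := hδle.trans ((min_le_left _ _).trans (min_le_right _ _))
    rwa [le_div_iff₀ hcD, mul_comm] at this
  have hδT : 1000 * δ ≤ W₀ := by
    have : δ ≤ W₀ / 1000 := hδle.trans (min_le_right _ _)
    rwa [le_div_iff₀ (by norm_num : (0:ℝ) < 1000), mul_comm] at this
  have bO : PZ.real (annulusOpenCrossing 0 δ W₀ W₁) ≤ ε / 2 := by
    refine (hO 0 δ W₀ W₁ hδ hδO h2W).trans ?_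
    rw [hratio]
    exact (hsmallO s ⟨hs, hsO⟩).le
  have bD : PZ.real (annulusDualCrossing 0 δ W₀ W₁) ≤ ε / 2 := by
    refine (hD 0 δ W₀ W₁ hδ hδD h2W).trans ?_
    rw [hratio]
    exact (hsmallD s ⟨hs, hsD⟩).le
  have bT : ∀ c : Bool, PT.real (triAnnulusCrossing c δ 0 W₀ W₁) ≤ ε / 2 := fun c => by
    refine (hT c δ 0 W₀ W₁ hδ hδT h2W).trans ?_
    rw [hratio]
    exact (hsmallT s ⟨hs, hsT⟩).le
  constructor
  · have hsub : {ω : BondConfig (Site 2) | ¬ ZdWindowGood δ W₀ W₁ ω} ⊆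
        annulusOpenCrossing 0 δ W₀ W₁ ∪ annulusDualCrossing 0 δ W₀ W₁ := by
      intro ω hω
      simp only [ZdWindowGood, mem_setOf_eq, not_and_or, not_not] at hω
      exact hω
    refine (measureReal_mono hsub).trans ((measureReal_union_le _ _).trans ?_)
    linarith
  · have hsub : {ω : SiteConfig (Site 2) | ¬ TriWindowGood δ W₀ W₁ ω} ⊆
        triAnnulusCrossing true δ 0 W₀ W₁ ∪ triAnnulusCrossing false δ 0 W₀ W₁ := by
      intro ω hω
      simp only [TriWindowGood, mem_setOf_eq, not_and_or, not_not] at hω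
      exact hω
    refine (measureReal_mono hsub).trans ((measureReal_union_le _ _).trans ?_)
    linarith [bT true, bT false]

/-- S3 from the two deterministic transfers T1, T2, the two dualities G1, G2, the window bounds of
the tree (`annulusOpenCrossing_half_le_holds`, `annulusDualCrossing_half_le_holds`,
`tri_annulusCrossing_bound_holds`) and the coupling provided by `X`
(`LoopConfig.exists_coupling_of_cnLawEDist_lt`). [folklore] -/
theorem monoTransfer_of (hG1 : ZdPlateDuality) (hG2 : TriPlateDuality) (hT1 : TransferVerticalTtoZ)
    (hT2 : TransferHorizontalZtoT) : MonoTransfer := by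
  intro hX Φ κ hκ hκ1 ε hε
  -- rooms
  have hν : 0 < κ / 20 := by positivity
  have hc : 0 < 3 * κ / 20 := by positivity
  have hc' : 0 < κ / 5 := by positivity
  obtain ⟨δ₁, hδ₁, hdualZ⟩ := hG1 Φ (κ / 20) hν
  obtain ⟨δ₂, hδ₂, hdualT⟩ := hG2 Φ (κ / 20) hν
  obtain ⟨η₁, hη₁, hT1'⟩ := hT1 Φ (κ / 5) hc'
  obtain ⟨η₂, hη₂, hT2'⟩ := hT2 Φ (3 * κ / 20) hc
  -- window
  have hε4 : 0 < ε / 4 := by positivity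
  obtain ⟨W₀, W₁, hW₀, hW₀₁, hW, δw, hδw, hwin⟩ := exists_window Φ hε4
  -- the coupling scale
  have hW₁pos : 0 < W₁ + 1 := by linarith
  set η : ℝ := min (min η₁ η₂) (min (1 / (W₁ + 1)) (ε / 4)) with hηdef
  have hηpos : 0 < η := lt_min (lt_min hη₁ hη₂) (lt_min (one_div_pos.2 hW₁pos) hε4)
  have hηη₁ : η ≤ η₁ := (min_le_left _ _).trans (min_le_left _ _)
  have hηη₂ : η ≤ η₂ := (min_le_left _ _).trans (min_le_right _ _)
  have hηW : W₁ + 1 ≤ 1 / η := by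
    have h1 : η ≤ 1 / (W₁ + 1) := (min_le_right _ _).trans (min_le_left _ _)
    rw [le_div_iff₀ hηpos]
    have := (le_div_iff₀ hW₁pos).1 h1
    linarith
  have hηε : η ≤ ε / 4 := (min_le_right _ _).trans (min_le_right _ _)
  obtain ⟨δ₃, hδ₃, hT1''⟩ := hT1' η hηpos hηη₁
  obtain ⟨δ₄, hδ₄, hT2''⟩ := hT2' η hηpos hηη₂
  -- the coupling from `X`
  have hX' : Tendsto (fun δ : ℝ ↦ LoopConfig.cnLawEDist PZ (bondLoopConfig δ 0) PT (siteLoopConfig δ))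
      (𝓝[>] 0) (𝓝 0) := hX
  have hevX : ∀ᶠ δ : ℝ in 𝓝[>] 0,
      LoopConfig.cnLawEDist PZ (bondLoopConfig δ 0) PT (siteLoopConfig δ) < ENNReal.ofReal η :=
    hX' (Iio_mem_nhds (ENNReal.ofReal_pos.2 hηpos))
  have hevδ : ∀ᶠ δ : ℝ in 𝓝[>] 0, δ ∈ Ioo 0 (min (min (min δ₁ δ₂) (min δ₃ δ₄)) δw) :=
    Ioo_mem_nhdsGT (lt_min (lt_min (lt_min hδ₁ hδ₂) (lt_min hδ₃ hδ₄)) hδw)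
  filter_upwards [hevX, hevδ] with δ hXδ hδ
  have hδpos : 0 < δ := hδ.1
  have hδ₁' : δ ≤ δ₁ := (hδ.2.trans_le ((min_le_left _ _).trans ((min_le_left _ _).trans (min_le_left _ _)))).le
  have hδ₂' : δ ≤ δ₂ := (hδ.2.trans_le ((min_le_left _ _).trans ((min_le_left _ _).trans (min_le_right _ _)))).le
  have hδ₃' : δ ≤ δ₃ := (hδ.2.trans_le ((min_le_left _ _).trans ((min_le_right _ _).trans (min_le_left _ _)))).le
  have hδ₄' : δ ≤ δ₄ := (hδ.2.trans_le ((min_le_left _ _).trans ((min_le_right _ _).trans (min_le_right _ _)))).le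
  have hδw' : δ ≤ δw := (hδ.2.trans_le (min_le_right _ _)).le
  obtain ⟨P, hP1, hP2, hPbad⟩ := LoopConfig.exists_coupling_of_cnLawEDist_lt hXδ
  haveI : IsProbabilityMeasure P := by
    refine ⟨?_⟩
    have hu : P.map Prod.fst univ = 1 := by rw [hP1, measure_univ]
    rwa [Measure.map_apply measurable_fst MeasurableSet.univ, preimage_univ] at hu
  -- events
  set Cl : Set (BondConfig (Site 2) × SiteConfig (Site 2)) :=
    {p | LoopConfig.IsClose η (bondLoopConfig δ 0 p.1) (siteLoopConfig δ p.2)} with hCl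
  set GZ : Set (BondConfig (Site 2)) := {ω | ZdWindowGood δ W₀ W₁ ω ∧ ω ⊆ (zdGraph 2).edgeSet} with hGZ
  set GT : Set (SiteConfig (Site 2)) := {ω | TriWindowGood δ W₀ W₁ ω} with hGT
  set MVZ : Set (BondConfig (Site 2)) := zdMV Φ δ (1 + 4 * κ / 5) (1 - 4 * κ / 5) (1 + 4 * κ / 5) with hMVZ
  set M3 : Set (SiteConfig (Site 2)) := triMV Φ δ (1 + 11 * κ / 20) (1 - 11 * κ / 20) (1 + 11 * κ / 20) with hM3
  set MHZ : Set (BondConfig (Site 2)) := zdMH Φ δ (1 + 3 * κ / 5) (1 + 4 * κ / 5) (1 - 3 * κ / 5) with hMHZ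
  set M4 : Set (SiteConfig (Site 2)) := triMH Φ δ (1 + 3 * κ / 10) (1 + 11 * κ / 20) (1 - 3 * κ / 10) with hM4
  -- bad-set probabilities
  have hPCl : P.real Clᶜ < η := by
    rw [measureReal_def]
    exact ENNReal.toReal_lt_of_lt_ofReal hPbad
  have hPGZ : P.real (Prod.fst ⁻¹' GZᶜ) ≤ ε / 4 := by
    refine (measureReal_preimage_fst_le_of_map_eq' hP1 _).trans ?_
    have hsub : GZᶜ ⊆ {ω | ¬ ZdWindowGood δ W₀ W₁ ω} ∪ {ω | ¬ ω ⊆ (zdGraph 2).edgeSet} := by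
      intro ω hω
      simp only [hGZ, mem_compl_iff, mem_setOf_eq, not_and_or] at hω
      exact hω
    refine (measureReal_mono hsub).trans ((measureReal_union_le _ _).trans ?_)
    have h0 : PZ.real {ω : BondConfig (Site 2) | ¬ ω ⊆ (zdGraph 2).edgeSet} = 0 := by
      rw [measureReal_def, ae_iff.1 (ae_subset_edgeSet (zdGraph 2) half), ENNReal.toReal_zero]
    rw [h0, add_zero]
    exact (hwin δ hδpos hδw').1
  have hPGT : P.real (Prod.snd ⁻¹' GTᶜ) ≤ ε / 4 :=
    (measureReal_preimage_snd_le_of_map_eq' hP2 _).trans (hwin δ hδpos hδw').2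
  -- measurability of the four plate events
  have hbox₁ : ∀ {a b : ℝ}, 0 ≤ a → a ≤ 2 → 0 ≤ b → b ≤ 2 → pbox a b ⊆ pbox 2 2 := by
    intro a b ha ha2 hb hb2 z hz
    exact ⟨⟨by linarith [hz.1.1], by linarith [hz.1.2]⟩, ⟨by linarith [hz.2.1], by linarith [hz.2.2]⟩⟩
  have hcm : Measurable (compl : SiteConfig (Site 2) → SiteConfig (Site 2)) :=
    measurable_set_iff.2 fun i => (measurable_set_mem i).not
  have hM3m : MeasurableSet M3 :=
    (measurableSet_triPlate hW hδpos (hbox₁ (by linarith) (by linarith) (by linarith) (by linarith)) _ _).union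
      (hcm (measurableSet_triPlate hW hδpos (hbox₁ (by linarith) (by linarith) (by linarith) (by linarith)) _ _))
  have hMHZm : MeasurableSet MHZ :=
    (measurableSet_openCrossing_site' _ _ _).union (measurable_dualConfig (measurableSet_openCrossing_site' _ _ _))
  -- (a) the inclusion behind `PT(M3) ≤ PZ(MVZ) + ε`
  have hincl_a : Prod.snd ⁻¹' M3 ⊆ Prod.fst ⁻¹' MVZ ∪ (Clᶜ ∪ Prod.fst ⁻¹' GZᶜ ∪ Prod.snd ⁻¹' GTᶜ) := by
    rintro ⟨ω, ω'⟩ hM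
    by_contra hcon
    simp only [mem_union, mem_preimage, mem_compl_iff, not_or, not_not] at hcon
    obtain ⟨hMV, ⟨hC, hgz⟩, hgt⟩ := hcon
    obtain ⟨hwz, hE⟩ := hgz
    -- duality on ℤ²: both horizontal crossings of H(x'-2ν, x', yin'+2ν)
    have hdz := (hdualZ δ hδpos hδ₁' ω hE).1 (1 + 4 * κ / 5) (1 - 4 * κ / 5) (1 + 4 * κ / 5)
      (by linarith) (by linarith) (by linarith) (by linarith) (by linarith)
    simp only [hMVZ, zdMV, mem_union, mem_preimage, not_or] at hMV
    have hHd := hdz.1 hMV.1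
    have hHp := hdz.2 hMV.2
    -- transfer to 𝕋
    have key := hT2'' δ hδpos hδ₄' W₀ W₁ hW hW₀₁ hηW (1 + 4 * κ / 5 - 2 * (κ / 20)) (1 + 4 * κ / 5)
      (1 - 4 * κ / 5 + 2 * (κ / 20)) (by linarith) (by linarith) (by linarith) (by linarith) (by linarith)
      ω ω' hE hC hwz hgt hHp hHd (1 + 11 * κ / 20)
    have e1 : 1 + 4 * κ / 5 - 2 * (κ / 20) - 3 * κ / 20 = 1 + 11 * κ / 20 := by ring
    have e2 : 1 - 4 * κ / 5 + 2 * (κ / 20) + 3 * κ / 20 = 1 - 11 * κ / 20 := by ring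
    rw [e1, e2] at key
    exact key hM
  -- (b) the inclusion behind `PZ(MHZ) ≤ PT(M4) + ε`
  have hincl_b : Prod.fst ⁻¹' MHZ ⊆ Prod.snd ⁻¹' M4 ∪ (Clᶜ ∪ Prod.fst ⁻¹' GZᶜ ∪ Prod.snd ⁻¹' GTᶜ) := by
    rintro ⟨ω, ω'⟩ hM
    by_contra hcon
    simp only [mem_union, mem_preimage, mem_compl_iff, not_or, not_not] at hcon
    obtain ⟨hM4', ⟨hC, hgz⟩, hgt⟩ := hcon
    obtain ⟨hwz, hE⟩ := hgz
    -- duality on 𝕋: both vertical crossings of V(xin₄+2ν, y₄-2ν, y₄)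
    have hdt := (hdualT δ hδpos hδ₂' ω').2 (1 + 3 * κ / 10) (1 + 11 * κ / 20) (1 - 3 * κ / 10)
      (by linarith) (by linarith) (by linarith) (by linarith) (by linarith)
    simp only [hM4, triMH, mem_union, mem_preimage, not_or] at hM4'
    have hVc := hdt.1 hM4'.1
    have hVo := hdt.2 hM4'.2
    have key := hT1'' δ hδpos hδ₃' W₀ W₁ hW hW₀₁ hηW (1 + 3 * κ / 10 + 2 * (κ / 20))
      (1 - 3 * κ / 10 - 2 * (κ / 20)) (1 - 3 * κ / 10) (by linarith) (by linarith) (by linarith)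
      (by linarith) (by linarith) ω ω' hE hC hwz hgt hVo hVc (1 + 4 * κ / 5)
    have e1 : 1 + 3 * κ / 10 + 2 * (κ / 20) + κ / 5 = 1 + 3 * κ / 5 := by ring
    have e2 : 1 - 3 * κ / 10 - 2 * (κ / 20) - κ / 5 = 1 - 3 * κ / 5 := by ring
    rw [e1, e2] at key
    exact key hM
  -- probabilities
  have hbad : P.real (Clᶜ ∪ Prod.fst ⁻¹' GZᶜ ∪ Prod.snd ⁻¹' GTᶜ) ≤ 3 * ε / 4 := by
    calc P.real (Clᶜ ∪ Prod.fst ⁻¹' GZᶜ ∪ Prod.snd ⁻¹' GTᶜ)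
        ≤ P.real (Clᶜ ∪ Prod.fst ⁻¹' GZᶜ) + P.real (Prod.snd ⁻¹' GTᶜ) := measureReal_union_le _ _
      _ ≤ P.real Clᶜ + P.real (Prod.fst ⁻¹' GZᶜ) + P.real (Prod.snd ⁻¹' GTᶜ) := by
          gcongr; exact measureReal_union_le _ _
      _ ≤ 3 * ε / 4 := by linarith [hPCl.le]
  constructor
  · have h1 : PT.real M3 = P.real (Prod.snd ⁻¹' M3) := by
      rw [← hP2, map_measureReal_apply measurable_snd hM3m]
    have h2 : P.real (Prod.fst ⁻¹' MVZ) ≤ PZ.real MVZ := measureReal_preimage_fst_le_of_map_eq' hP1 _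
    have h3 : P.real (Prod.snd ⁻¹' M3) ≤ P.real (Prod.fst ⁻¹' MVZ) + P.real (Clᶜ ∪ Prod.fst ⁻¹' GZᶜ ∪ Prod.snd ⁻¹' GTᶜ) :=
      (measureReal_mono hincl_a).trans (measureReal_union_le _ _)
    rw [h1]
    linarith
  · have h1 : PZ.real MHZ = P.real (Prod.fst ⁻¹' MHZ) := by
      rw [← hP1, map_measureReal_apply measurable_fst hMHZm]
    have h2 : P.real (Prod.snd ⁻¹' M4) ≤ PT.real M4 := measureReal_preimage_snd_le_of_map_eq' hP2 _
    have h3 : P.real (Prod.fst ⁻¹' MHZ) ≤ P.real (Prod.snd ⁻¹' M4) + P.real (Clᶜ ∪ Prod.fst ⁻¹' GZᶜ ∪ Prod.snd ⁻¹' GTᶜ) :=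
      (measureReal_mono hincl_b).trans (measureReal_union_le _ _)
    rw [h1]
    linarith

end Summit.CriticalPhenomena.CardyFormulaZ2.Cruxes.LoopsToCrossings.OracleSandwich

end
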